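import Summits.Ventures.YMGap.RobustBall.UniformPlaquetteDecay
import Summits.Ventures.YMGap.Thresholds.PlaquetteSusceptibility
import HarnessLib

/-!
# Venture YMGap, track ROBUST-BALL (Y2) — a UNIFORM plaquette-susceptibility bound on the balls

HONEST FRAMING. WHAT THIS IS: a venture file (cell `pub-ymgap`, track Y2 ROBUST-BALL, seat rb-p1, theorems only).
ds-1's `PlaquetteSusceptibility.summable_abs_cov_plaquette_of_massGapAt` gives, for each DLR state separately, SOME finite
susceptibility `χ` (the currency `MassGapAt` hides the constants). On the balls the uniform currencies of `UniformMassGap.lean`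
carry one `(m, A)`, so the plaquette susceptibility `χ_p(μ) = Σ_q |Cov_μ(W_p, W_q)|` (sum over ALL plaquettes `q` of `ℤ^d`,
`W_p = (1/N) Re tr U_p`) is bounded by ONE EXPLICIT `χ` for every member of the ball, every DLR state and every base plaquette:
* `exp_neg_norm_le_pow` — `e^{−m‖v‖_∞} ≤ (e^{−m/d})^{‖v‖₁}`; `summable_abs_cov_plaquette_of_bound` — a plaquette two-point bound
  `|Cov(W_p(x), W_q(y))| ≤ C e^{−m‖x−y‖_∞}` (`m > 0`) gives summability and `Σ_q |Cov| ≤ C · numOrient d · ((1+r)/(1−r))^d`,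
  `r = e^{−m/d}` (the tree's geometric lattice sum `summable_and_tsum_row_le`);
* `PerturbedClustering[S].susceptibility_le` — member level with clustering data `(m, A)`;
* ball level, ONE `χ` FOR THE WHOLE BALL: `UniformMassGapOnBallZd.susceptibility_le`, `…ZdS…`, `…ZdG…` (ds-2's gauge ball),
  `UniformMassGapOnLoopBall.susceptibility_le` — with
  `χ = max(max(16A,0)e^{2m}(4N³·4N³+1), 4e^{2m}) · numOrient d · ((1 + e^{−m/d})/(1 − e^{−m/d}))^d`.
READING: inside each certified ball the plaquette susceptibility is UNIFORMLY BOUNDED — no member of the ball and no DLR state of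
a member can have a divergent susceptibility (the lattice signature of a continuous transition is excluded uniformly, not just
member by member). WHAT THIS IS NOT: `χ` is explicit but not optimised (Dobrushin constants); strong-coupling LATTICE statement,
nothing about the continuum limit or a Clay-sense mass gap.
-/

noncomputable section

open MeasureTheory Filter Function ProbabilityTheory Real
open scoped NNReal
open Literature.Probability.LatticeModels
open Literature.Probability.LatticeModels.DobrushinMetric
open Literature.MathematicalPhysics.QuantumLattice
open Literature.MathematicalPhysics.QuantumFieldTheory hiding ZdEdge Site
open Summit.Ventures.YMGap.PlaquetteSusceptibility (l1_le_mul_norm)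

namespace Summit.Ventures.YMGap.RobustBall

variable {d N : ℕ}

/-! ### From a sup-norm two-point bound to a summable row -/

/-- `e^{−m‖v‖_∞} ≤ (e^{−m/d})^{‖v‖₁}` for `m ≥ 0`, `d ≥ 1` (`‖v‖₁ ≤ d‖v‖_∞`). [folklore] -/
theorem exp_neg_norm_le_pow (hd : 1 ≤ d) {m : ℝ} (hm : 0 ≤ m) (v : Literature.Probability.LatticeModels.Site d) :
    exp (-m * ‖v‖) ≤ exp (-(m / d)) ^ l1 v := by
  have hd0 : (0 : ℝ) < d := by exact_mod_cast hd
  rw [← Real.exp_nat_mul]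
  refine exp_le_exp.2 ?_
  have h1 : (l1 v : ℝ) ≤ d * ‖v‖ := l1_le_mul_norm v
  have h2 : (l1 v : ℝ) * (m / d) ≤ m * ‖v‖ := by
    rw [mul_div_assoc', div_le_iff₀ hd0]
    nlinarith
  linarith

/-- **A sup-norm plaquette two-point bound gives a UNIFORMLY SUMMABLE ROW**: if `|Cov_μ(W_p(x), W_q(y))| ≤ C e^{−m‖x−y‖_∞}` for all
plaquettes (`C ≥ 0`, `m > 0`, `d ≥ 1`), then for every base plaquette `p` the row `q ↦ |Cov_μ(W_p, W_q)|` is summable over all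
plaquettes of `ℤ^d` and `Σ_q |Cov| ≤ C · numOrient d · ((1 + r)/(1 − r))^d`, `r = e^{−m/d}` (`summable_and_tsum_row_le`). [folklore] -/
theorem summable_abs_cov_plaquette_of_bound (hd : 1 ≤ d) {μ : Measure (LGConfig d (Matrix.specialUnitaryGroup (Fin N) ℂ))}
    {C m : ℝ} (hC : 0 ≤ C) (hm : 0 < m)
    (h : ∀ (x y : Literature.Probability.LatticeModels.Site d) (i j k l : Fin d) (hij : i < j) (hkl : k < l),
      |cov[zdPlaquetteObs (fundamentalRep (Fin N)) x i j, zdPlaquetteObs (fundamentalRep (Fin N)) y k l; μ]| ≤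
        C * exp (-m * ‖x - y‖))
    (p : ZdPlaquette d) :
    Summable (fun q : ZdPlaquette d => |cov[zdPlaquetteObs (fundamentalRep (Fin N)) p.1 p.2.1.1 p.2.1.2,
        zdPlaquetteObs (fundamentalRep (Fin N)) q.1 q.2.1.1 q.2.1.2; μ]|) ∧
      ∑' q : ZdPlaquette d, |cov[zdPlaquetteObs (fundamentalRep (Fin N)) p.1 p.2.1.1 p.2.1.2,
        zdPlaquetteObs (fundamentalRep (Fin N)) q.1 q.2.1.1 q.2.1.2; μ]| ≤
        C * (numOrient d * ((1 + exp (-(m / d))) / (1 - exp (-(m / d)))) ^ d) := by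
  set r : ℝ := exp (-(m / d)) with hr
  have hr0 : 0 ≤ r := (exp_pos _).le
  have hdpos : (0 : ℝ) < d := by exact_mod_cast (show 0 < d by omega)
  have hr1 : r < 1 := by
    rw [hr]
    exact Real.exp_lt_one_iff.2 (neg_neg_of_pos (div_pos hm hdpos))
  have hpt : ∀ q : ZdPlaquette d, |cov[zdPlaquetteObs (fundamentalRep (Fin N)) p.1 p.2.1.1 p.2.1.2,
        zdPlaquetteObs (fundamentalRep (Fin N)) q.1 q.2.1.1 q.2.1.2; μ]| ≤ C * r ^ l1 (p.1 - q.1) := by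
    intro q
    refine (h p.1 q.1 _ _ _ _ p.2.2 q.2.2).trans (mul_le_mul_of_nonneg_left ?_ hC)
    simpa only [hr, neg_mul] using exp_neg_norm_le_pow hd hm.le (p.1 - q.1)
  have hrow := summable_and_tsum_row_le (d := d) hC hr0 hr1 p
  have hsum : Summable fun q : ZdPlaquette d => |cov[zdPlaquetteObs (fundamentalRep (Fin N)) p.1 p.2.1.1 p.2.1.2,
        zdPlaquetteObs (fundamentalRep (Fin N)) q.1 q.2.1.1 q.2.1.2; μ]| :=
    Summable.of_nonneg_of_le (fun q => abs_nonneg _) hpt hrow.1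
  exact ⟨hsum, (hsum.tsum_le_tsum hpt hrow.1).trans hrow.2⟩

/-! ### Members with clustering data `(m, A)` -/

section Member

variable {β m A : ℝ} {W : Potential (ZdEdge d) (Matrix.specialUnitaryGroup (Fin N) ℂ)}
  {supp : Finset (ZdEdge d) → Finset (Finset (ZdEdge d))}

/-- **Plaquette susceptibility of a member with clustering data `(m, A)`**, every DLR state, every base plaquette:
`Σ_q |Cov_μ(W_p, W_q)| ≤ max(max(16A,0)e^{2m}(4N³·4N³+1), 4e^{2m}) · numOrient d · ((1+e^{−m/d})/(1−e^{−m/d}))^d`. [folklore] -/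
theorem PerturbedClustering.susceptibility_le (hd : 1 ≤ d) (h : PerturbedClustering d N β W supp m A) (hm : 0 < m)
    {μ : Measure (LGConfig d (Matrix.specialUnitaryGroup (Fin N) ℂ))}
    (hμ : μ ∈ perturbedGibbsMeasures (d := d) (fundamentalRep (Fin N)) (N * β) W supp) (p : ZdPlaquette d) :
    Summable (fun q : ZdPlaquette d => |cov[zdPlaquetteObs (fundamentalRep (Fin N)) p.1 p.2.1.1 p.2.1.2,
        zdPlaquetteObs (fundamentalRep (Fin N)) q.1 q.2.1.1 q.2.1.2; μ]|) ∧
      ∑' q : ZdPlaquette d, |cov[zdPlaquetteObs (fundamentalRep (Fin N)) p.1 p.2.1.1 p.2.1.2,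
        zdPlaquetteObs (fundamentalRep (Fin N)) q.1 q.2.1.1 q.2.1.2; μ]| ≤
        max (max (A * (4 : ℕ) ^ 2) 0 * Real.exp (2 * m) *
            (((4 * (N : ℝ≥0) ^ 3 : ℝ≥0) : ℝ) * ((4 * (N : ℝ≥0) ^ 3 : ℝ≥0) : ℝ) + 1))
          (4 * Real.exp (2 * m)) * (numOrient d * ((1 + exp (-(m / d))) / (1 - exp (-(m / d)))) ^ d) :=
  summable_abs_cov_plaquette_of_bound hd (le_max_of_le_right (by positivity)) hm
    (fun x y _ _ _ _ hij hkl => h.abs_cov_plaquette_le hm hμ x y hij hkl) p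

/-- The tier-2 twin. [folklore] -/
theorem PerturbedClusteringS.susceptibility_le (hd : 1 ≤ d) (h : PerturbedClusteringS d N β W m A) (hm : 0 < m)
    {μ : Measure (LGConfig d (Matrix.specialUnitaryGroup (Fin N) ℂ))}
    (hμ : μ ∈ perturbedGibbsMeasuresS (d := d) (fundamentalRep (Fin N)) (N * β) W) (p : ZdPlaquette d) :
    Summable (fun q : ZdPlaquette d => |cov[zdPlaquetteObs (fundamentalRep (Fin N)) p.1 p.2.1.1 p.2.1.2,
        zdPlaquetteObs (fundamentalRep (Fin N)) q.1 q.2.1.1 q.2.1.2; μ]|) ∧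
      ∑' q : ZdPlaquette d, |cov[zdPlaquetteObs (fundamentalRep (Fin N)) p.1 p.2.1.1 p.2.1.2,
        zdPlaquetteObs (fundamentalRep (Fin N)) q.1 q.2.1.1 q.2.1.2; μ]| ≤
        max (max (A * (4 : ℕ) ^ 2) 0 * Real.exp (2 * m) *
            (((4 * (N : ℝ≥0) ^ 3 : ℝ≥0) : ℝ) * ((4 * (N : ℝ≥0) ^ 3 : ℝ≥0) : ℝ) + 1))
          (4 * Real.exp (2 * m)) * (numOrient d * ((1 + exp (-(m / d))) / (1 - exp (-(m / d)))) ^ d) :=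
  summable_abs_cov_plaquette_of_bound hd (le_max_of_le_right (by positivity)) hm
    (fun x y _ _ _ _ hij hkl => h.abs_cov_plaquette_le hm hμ x y hij hkl) p

end Member

/-! ### The balls: ONE susceptibility bound for every member and every DLR state -/

section Balls

variable {β ε₀ ε₁ R a Λ t w ε m A : ℝ}

/-- **UNIFORM PLAQUETTE SUSCEPTIBILITY ON THE TIER-1 BALL** `MemBallZd ε₀ ε₁ R`: one explicit `χ` for every member, every DLR state,
every base plaquette. [folklore] -/
theorem UniformMassGapOnBallZd.susceptibility_le (hd : 1 ≤ d) (h : UniformMassGapOnBallZd d N β ε₀ ε₁ R m A)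
    {W : Potential (ZdEdge d) (Matrix.specialUnitaryGroup (Fin N) ℂ)}
    {supp : Finset (ZdEdge d) → Finset (Finset (ZdEdge d))} (hW : MemBallZd ε₀ ε₁ R W supp)
    {μ : Measure (LGConfig d (Matrix.specialUnitaryGroup (Fin N) ℂ))}
    (hμ : μ ∈ perturbedGibbsMeasures (d := d) (fundamentalRep (Fin N)) (N * β) W supp) (p : ZdPlaquette d) :
    Summable (fun q : ZdPlaquette d => |cov[zdPlaquetteObs (fundamentalRep (Fin N)) p.1 p.2.1.1 p.2.1.2,
        zdPlaquetteObs (fundamentalRep (Fin N)) q.1 q.2.1.1 q.2.1.2; μ]|) ∧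
      ∑' q : ZdPlaquette d, |cov[zdPlaquetteObs (fundamentalRep (Fin N)) p.1 p.2.1.1 p.2.1.2,
        zdPlaquetteObs (fundamentalRep (Fin N)) q.1 q.2.1.1 q.2.1.2; μ]| ≤
        max (max (A * (4 : ℕ) ^ 2) 0 * Real.exp (2 * m) *
            (((4 * (N : ℝ≥0) ^ 3 : ℝ≥0) : ℝ) * ((4 * (N : ℝ≥0) ^ 3 : ℝ≥0) : ℝ) + 1))
          (4 * Real.exp (2 * m)) * (numOrient d * ((1 + exp (-(m / d))) / (1 - exp (-(m / d)))) ^ d) :=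
  (h.2 W supp hW).2.susceptibility_le hd h.1 hμ p

/-- **UNIFORM PLAQUETTE SUSCEPTIBILITY ON THE TIER-2 (WEIGHTED) BALL** `MemBallZdS a Λ t`. [folklore] -/
theorem UniformMassGapOnBallZdS.susceptibility_le (hd : 1 ≤ d) (h : UniformMassGapOnBallZdS d N β a Λ t m A)
    {W : Potential (ZdEdge d) (Matrix.specialUnitaryGroup (Fin N) ℂ)} (hW : MemBallZdS a Λ t W)
    {μ : Measure (LGConfig d (Matrix.specialUnitaryGroup (Fin N) ℂ))}
    (hμ : μ ∈ perturbedGibbsMeasuresS (d := d) (fundamentalRep (Fin N)) (N * β) W) (p : ZdPlaquette d) :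
    Summable (fun q : ZdPlaquette d => |cov[zdPlaquetteObs (fundamentalRep (Fin N)) p.1 p.2.1.1 p.2.1.2,
        zdPlaquetteObs (fundamentalRep (Fin N)) q.1 q.2.1.1 q.2.1.2; μ]|) ∧
      ∑' q : ZdPlaquette d, |cov[zdPlaquetteObs (fundamentalRep (Fin N)) p.1 p.2.1.1 p.2.1.2,
        zdPlaquetteObs (fundamentalRep (Fin N)) q.1 q.2.1.1 q.2.1.2; μ]| ≤
        max (max (A * (4 : ℕ) ^ 2) 0 * Real.exp (2 * m) *
            (((4 * (N : ℝ≥0) ^ 3 : ℝ≥0) : ℝ) * ((4 * (N : ℝ≥0) ^ 3 : ℝ≥0) : ℝ) + 1))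
          (4 * Real.exp (2 * m)) * (numOrient d * ((1 + exp (-(m / d))) / (1 - exp (-(m / d)))) ^ d) :=
  (h.2 W hW).2.susceptibility_le hd h.1 hμ p

/-- **UNIFORM PLAQUETTE SUSCEPTIBILITY ON ds-2's GAUGE-INVARIANT BALL** `MemBallZdG ε₀ ε₁ R`. [folklore] -/
theorem UniformMassGapOnBallZdG.susceptibility_le (hd : 1 ≤ d) {R : ℕ} (h : UniformMassGapOnBallZdG d N β ε₀ ε₁ R m A)
    {W : Potential (ZdEdge d) (SUN N)} {supp : Finset (ZdEdge d) → Finset (Finset (ZdEdge d))}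
    (hW : MemBallZdG ε₀ ε₁ R W supp) {μ : Measure (LGConfig d (SUN N))}
    (hμ : μ ∈ perturbedGibbsMeasures (d := d) (fundamentalRep (Fin N)) (N * β) W supp) (p : ZdPlaquette d) :
    Summable (fun q : ZdPlaquette d => |cov[zdPlaquetteObs (fundamentalRep (Fin N)) p.1 p.2.1.1 p.2.1.2,
        zdPlaquetteObs (fundamentalRep (Fin N)) q.1 q.2.1.1 q.2.1.2; μ]|) ∧
      ∑' q : ZdPlaquette d, |cov[zdPlaquetteObs (fundamentalRep (Fin N)) p.1 p.2.1.1 p.2.1.2,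
        zdPlaquetteObs (fundamentalRep (Fin N)) q.1 q.2.1.1 q.2.1.2; μ]| ≤
        max (max (A * (4 : ℕ) ^ 2) 0 * Real.exp (2 * m) *
            (((4 * (N : ℝ≥0) ^ 3 : ℝ≥0) : ℝ) * ((4 * (N : ℝ≥0) ^ 3 : ℝ≥0) : ℝ) + 1))
          (4 * Real.exp (2 * m)) * (numOrient d * ((1 + exp (-(m / d))) / (1 - exp (-(m / d)))) ^ d) :=
  (h.2 W supp hW).2.susceptibility_le hd h.1 hμ p

/-- **UNIFORM PLAQUETTE SUSCEPTIBILITY ON THE LOOP-ACTION NORM BALL `‖c‖_w ≤ ε`**: for EVERY generic Wilson-type loop action with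
finite carrier fibres and `LoopNormLE w γ c ε`, every DLR state, every base plaquette — one explicit `χ`. [folklore] -/
theorem UniformMassGapOnLoopBall.susceptibility_le (hd : 1 ≤ d) (h : UniformMassGapOnLoopBall d N β w ε m A)
    {ι : Type} {γ : ι → ZdLoop d} {c : ι → ℝ} (hfin : ∀ X, {i | walkEdges (γ i).walk = X}.Finite)
    (hn : LoopNormLE w γ c ε) {μ : Measure (LGConfig d (SUN N))}
    (hμ : μ ∈ perturbedGibbsMeasuresS (d := d) (fundamentalRep (Fin N)) (N * β) (loopFamilyAction (d := d) N γ c))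
    (p : ZdPlaquette d) :
    Summable (fun q : ZdPlaquette d => |cov[zdPlaquetteObs (fundamentalRep (Fin N)) p.1 p.2.1.1 p.2.1.2,
        zdPlaquetteObs (fundamentalRep (Fin N)) q.1 q.2.1.1 q.2.1.2; μ]|) ∧
      ∑' q : ZdPlaquette d, |cov[zdPlaquetteObs (fundamentalRep (Fin N)) p.1 p.2.1.1 p.2.1.2,
        zdPlaquetteObs (fundamentalRep (Fin N)) q.1 q.2.1.1 q.2.1.2; μ]| ≤
        max (max (A * (4 : ℕ) ^ 2) 0 * Real.exp (2 * m) *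
            (((4 * (N : ℝ≥0) ^ 3 : ℝ≥0) : ℝ) * ((4 * (N : ℝ≥0) ^ 3 : ℝ≥0) : ℝ) + 1))
          (4 * Real.exp (2 * m)) * (numOrient d * ((1 + exp (-(m / d))) / (1 - exp (-(m / d)))) ^ d) :=
  (h.2 ι γ c hfin hn).2.susceptibility_le hd h.1 hμ p

end Balls

end Summit.Ventures.YMGap.RobustBall

end
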